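import Mathlib
import HarnessLib
import Summits.NavierStokesRegularity.NavierStokesRegularity.Theorems.PoloidalWindowDoorLrcModEntireFrequencyLock
import Summits.NavierStokesRegularity.NavierStokesRegularity.Theorems.PoloidalWindowDoorLrcModEntireSonicSheetTrig

/-!
# Route `PoloidalWindowDoor`, item `LrcModEntire` (stmt-NavierStokesRegularity-20428), cell (Q4-sonic, straight, μ < 0) `stub_Q4sonicLineNeg`, case I —
# THE FREQUENCY OF THE SHEET DATA IS LOCKED ON A TIME INTERVAL (class-free form of S3(f), T2B-g17 §5(5d) / §7 S3(f) / §8(8c))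

Cell ns-regularity-ideate, stub-worker seat ns-poloidal-K2-p2 g17 under the LEAD of item 20428 (ns-poloidal-K2-p3 g17, PICK 2026-08-29T20:07:35Z);
`--supports stmt-NavierStokesRegularity-20428 --as helper`.  Class-free real analysis over LEAD's `…FrequencyLock.frequency_locked` (B-FREQ).

Setting: an open preconnected set of times `J`, a function `K(τ, s)` which is `C^∞` on the strip `J × ℝ` (in the application `K(τ,s) = S_eν(τ; s, 0)`, the
cross strain on the web sheet at time `−1+τ` and height `0`), such that for every `τ ∈ J` the slice `K(τ,·)` is a sinusoid `a cos(ws) + b sin(ws)` of SOME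
frequency `w > 0` (the oscillatory branch of `…SonicSheetStrain` at every time of `J`), non-zero at a fixed `s₀`, and `K` is LIPSCHITZ IN TIME UNIFORMLY IN `s`
(`|K(τ',s) − K(τ,s)| ≤ M|τ' − τ|` near every `τ`, `M = M(τ)` the same for all `s`; in the application `M` comes from the class bounds on `D²U` and on
`∂_tDU`).  Then

* ★ `locked_frequency` — **there is ONE `w₀ > 0` such that every sinusoidal representation of every slice `K(τ,·)`, `τ ∈ J`, has frequency `w₀`.**

Mechanism: `w(τ)² = −∂_s²K(τ,s₀)/K(τ,s₀)` is differentiable in `τ` (no analyticity in time is used), the slices are `α(τ)cos(w(τ)s) + β(τ)sin(w(τ)s)` with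
`α = K(·,0)`, `β = ∂_sK(·,0)/w` differentiable, the `τ`-derivative `α′cos + β′sin + w′·s·(−α sin + β cos)` is bounded by `M` (converse mean value inequality
`HasDerivAt.le_of_lip'`), so `frequency_locked` gives `w′α = w′β = 0`, i.e. `w′ = 0` on `J`; `J` is preconnected.
Tools: `isOpen_strip`, `trig_hasDerivAt`, `slice_derivs_of_trig` (the `s`-derivatives of a sinusoidal slice), `sq_freq_eq` (the frequency is determined by the slice).

WHAT THIS IS NOT: not a claim about Navier–Stokes regularity and not a stub of the registry; a class-free lemma for the residual research cell `stub_Q4sonicLineNeg`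
of `Cruxes/LrcModEntire/Lines/twist_split.lean` v13 (bears_on LADDER-NS N0 via item 20428; items 20428 / 19708 / 27893 OPEN).
-/

noncomputable section

set_option linter.dupNamespace false
set_option linter.style.longLine false

namespace Summit.NavierStokesRegularity.NavierStokesRegularity.Theorems.PoloidalWindowDoorLrcModEntireSonicSheetFrequency

open Set Function Filter Topology
open scoped ContDiff
open Summit.NavierStokesRegularity.NavierStokesRegularity.Theorems.PoloidalWindowDoorLrcModEntireFrequencyLock
open Summit.NavierStokesRegularity.NavierStokesRegularity.Theorems.PoloidalWindowDoorLrcModEntireSeparatedHarmonic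
open Summit.NavierStokesRegularity.NavierStokesRegularity.Theorems.PoloidalWindowDoorLrcModEntireSonicSheetTrig

/-- The time strip `J × ℝ = Prod.fst ⁻¹' J` over an open set of times is open. -/
theorem isOpen_strip {J : Set ℝ} (hJ : IsOpen J) : IsOpen (Prod.fst ⁻¹' J : Set (ℝ × ℝ)) := hJ.preimage continuous_fst

/-- Derivative of a sinusoid `a cos(ws) + b sin(ws)`. -/
theorem trig_hasDerivAt (a b w s : ℝ) :
    HasDerivAt (fun x => a * Real.cos (w * x) + b * Real.sin (w * x)) (-a * w * Real.sin (w * s) + b * w * Real.cos (w * s)) s := by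
  have h := ((hasDerivAt_cos_mul w s).const_mul a).add ((hasDerivAt_sin_mul w s).const_mul b)
  exact h.congr_deriv (by ring)

variable {J : Set ℝ} {K : ℝ × ℝ → ℝ}

/-- **The `s`-derivatives of a sinusoidal slice.**  If `K` is `C^∞` on the open strip over `J`, `τ ∈ J` and `K(τ,s) = a cos(ws) + b sin(ws)` for all `s`, then
`∂_sK(τ,s) = −aw sin(ws) + bw cos(ws)` and `∂_s²K(τ,s) = −w²·K(τ,s)` (partial derivatives as `fderiv … (0,1)`). -/
theorem slice_derivs_of_trig (hJ : IsOpen J) (hK : ContDiffOn ℝ ∞ K (Prod.fst ⁻¹' J : Set (ℝ × ℝ))) {τ : ℝ} (hτ : τ ∈ J) {w a b : ℝ}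
    (hrep : ∀ s, K (τ, s) = a * Real.cos (w * s) + b * Real.sin (w * s)) (s : ℝ) :
    fderiv ℝ K (τ, s) ((0 : ℝ), (1 : ℝ)) = -a * w * Real.sin (w * s) + b * w * Real.cos (w * s) ∧
      fderiv ℝ (fun p => fderiv ℝ K p ((0 : ℝ), (1 : ℝ))) (τ, s) ((0 : ℝ), (1 : ℝ)) = -(w ^ 2) * K (τ, s) := by
  have hS := isOpen_strip hJ
  have hmem : ∀ s' : ℝ, ((τ, s') : ℝ × ℝ) ∈ (Prod.fst ⁻¹' J : Set (ℝ × ℝ)) := fun s' => hτ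
  have hKs : ContDiffOn ℝ ∞ (fun p => fderiv ℝ K p ((0 : ℝ), (1 : ℝ))) (Prod.fst ⁻¹' J : Set (ℝ × ℝ)) :=
    (hK.fderiv_of_isOpen hS (by simp)).clm_apply contDiffOn_const
  have hKd : ∀ s' : ℝ, DifferentiableAt ℝ K (τ, s') := fun s' => (hK.contDiffAt (hS.mem_nhds (hmem s'))).differentiableAt (by simp)
  have hKsd : ∀ s' : ℝ, DifferentiableAt ℝ (fun p => fderiv ℝ K p ((0 : ℝ), (1 : ℝ))) (τ, s') := fun s' =>
    (hKs.contDiffAt (hS.mem_nhds (hmem s'))).differentiableAt (by simp)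
  -- first derivative
  have h1 : ∀ s' : ℝ, fderiv ℝ K (τ, s') ((0 : ℝ), (1 : ℝ)) = -a * w * Real.sin (w * s') + b * w * Real.cos (w * s') := by
    intro s'
    have hd : HasDerivAt (fun x : ℝ => K (τ, x)) (fderiv ℝ K (τ, s') ((0 : ℝ), (1 : ℝ))) s' := hasDerivAt_slice_snd (p := (τ, s')) (hKd s')
    have heq : (fun x : ℝ => K (τ, x)) = fun x => a * Real.cos (w * x) + b * Real.sin (w * x) := funext hrep
    rw [heq] at hd
    exact hd.unique (trig_hasDerivAt a b w s')
  refine ⟨h1 s, ?_⟩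
  have hd : HasDerivAt (fun x : ℝ => fderiv ℝ K (τ, x) ((0 : ℝ), (1 : ℝ)))
      (fderiv ℝ (fun p => fderiv ℝ K p ((0 : ℝ), (1 : ℝ))) (τ, s) ((0 : ℝ), (1 : ℝ))) s :=
    hasDerivAt_slice_snd (F := fun p => fderiv ℝ K p ((0 : ℝ), (1 : ℝ))) (p := (τ, s)) (hKsd s)
  have heq : (fun x : ℝ => fderiv ℝ K (τ, x) ((0 : ℝ), (1 : ℝ))) = fun x => (b * w) * Real.cos (w * x) + (-a * w) * Real.sin (w * x) := by
    funext x; rw [h1 x]; ring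
  rw [heq] at hd
  have h2 := hd.unique (trig_hasDerivAt (b * w) (-a * w) w s)
  rw [h2, hrep s]
  ring

/-- **The frequency is determined by the slice**: with the hypotheses of `slice_derivs_of_trig` and `K(τ,s₀) ≠ 0`,
`w² = −∂_s²K(τ,s₀)/K(τ,s₀)`. -/
theorem sq_freq_eq (hJ : IsOpen J) (hK : ContDiffOn ℝ ∞ K (Prod.fst ⁻¹' J : Set (ℝ × ℝ))) {τ : ℝ} (hτ : τ ∈ J) {w a b : ℝ}
    (hrep : ∀ s, K (τ, s) = a * Real.cos (w * s) + b * Real.sin (w * s)) {s₀ : ℝ} (hne : K (τ, s₀) ≠ 0) :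
    w ^ 2 = -(fderiv ℝ (fun p => fderiv ℝ K p ((0 : ℝ), (1 : ℝ))) (τ, s₀) ((0 : ℝ), (1 : ℝ))) / K (τ, s₀) := by
  rw [(slice_derivs_of_trig hJ hK hτ hrep s₀).2, neg_mul, neg_neg, mul_div_assoc, div_self hne, mul_one]

/-- ★ **LOCKED FREQUENCY ON A TIME INTERVAL.**  `J` open and preconnected; `K ∈ C^∞` on the strip `J × ℝ`; every slice `K(τ,·)`, `τ ∈ J`, is a sinusoid of
some positive frequency; `K(τ,s₀) ≠ 0` for `τ ∈ J`; and `K` is Lipschitz in `τ` near every `τ ∈ J`, with a constant `M(τ)` serving all `s`.  Then ONE frequency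
`w₀ > 0` serves every slice: every sinusoidal representation of `K(τ,·)` (`τ ∈ J`) with positive frequency has frequency `w₀`. -/
theorem locked_frequency (hJ : IsOpen J) (hJc : IsPreconnected J) (hK : ContDiffOn ℝ ∞ K (Prod.fst ⁻¹' J : Set (ℝ × ℝ))) {s₀ : ℝ}
    (htrig : ∀ τ ∈ J, ∃ w a b : ℝ, 0 < w ∧ ∀ s, K (τ, s) = a * Real.cos (w * s) + b * Real.sin (w * s))
    (hne : ∀ τ ∈ J, K (τ, s₀) ≠ 0)
    (hlip : ∀ τ ∈ J, ∃ M : ℝ, 0 ≤ M ∧ ∀ s : ℝ, ∀ᶠ τ' in 𝓝 τ, |K (τ', s) - K (τ, s)| ≤ M * |τ' - τ|) :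
    ∃ w₀ : ℝ, 0 < w₀ ∧ ∀ τ ∈ J, ∀ w a b : ℝ, 0 < w → (∀ s, K (τ, s) = a * Real.cos (w * s) + b * Real.sin (w * s)) → w = w₀ := by
  have hS := isOpen_strip hJ
  set Ks : ℝ × ℝ → ℝ := fun p => fderiv ℝ K p ((0 : ℝ), (1 : ℝ)) with hKs_def
  set Kss : ℝ × ℝ → ℝ := fun p => fderiv ℝ Ks p ((0 : ℝ), (1 : ℝ)) with hKss_def
  have hKs : ContDiffOn ℝ ∞ Ks (Prod.fst ⁻¹' J : Set (ℝ × ℝ)) := (hK.fderiv_of_isOpen hS (by simp)).clm_apply contDiffOn_const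
  have hKss : ContDiffOn ℝ ∞ Kss (Prod.fst ⁻¹' J : Set (ℝ × ℝ)) := (hKs.fderiv_of_isOpen hS (by simp)).clm_apply contDiffOn_const
  -- the squared frequency as a function of time
  set Ω : ℝ → ℝ := fun τ => -(Kss (τ, s₀)) / K (τ, s₀) with hΩ_def
  have hΩrep : ∀ τ ∈ J, ∀ w a b : ℝ, (∀ s, K (τ, s) = a * Real.cos (w * s) + b * Real.sin (w * s)) → w ^ 2 = Ω τ :=
    fun τ hτ w a b hrep => sq_freq_eq hJ hK hτ hrep (hne τ hτ)
  set om : ℝ → ℝ := fun τ => Real.sqrt (Ω τ) with hom_def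
  have homrep : ∀ τ ∈ J, ∀ w a b : ℝ, 0 < w → (∀ s, K (τ, s) = a * Real.cos (w * s) + b * Real.sin (w * s)) → w = om τ := by
    intro τ hτ w a b hw hrep
    rw [hom_def]; simp only
    rw [← hΩrep τ hτ w a b hrep, Real.sqrt_sq hw.le]
  have hompos : ∀ τ ∈ J, 0 < om τ := by
    intro τ hτ
    obtain ⟨w, a, b, hw, hrep⟩ := htrig τ hτ
    rw [← homrep τ hτ w a b hw hrep]; exact hw
  have hΩpos : ∀ τ ∈ J, 0 < Ω τ := by
    intro τ hτ
    obtain ⟨w, a, b, hw, hrep⟩ := htrig τ hτ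
    rw [← hΩrep τ hτ w a b hrep]; positivity
  -- differentiability along the time line
  have hline : ∀ (s τ : ℝ), HasDerivAt (fun τ' : ℝ => ((τ', s) : ℝ × ℝ)) ((1 : ℝ), (0 : ℝ)) τ := fun s τ =>
    (hasDerivAt_id τ).prodMk (hasDerivAt_const τ s)
  have hsliceT : ∀ {F : ℝ × ℝ → ℝ}, ContDiffOn ℝ ∞ F (Prod.fst ⁻¹' J : Set (ℝ × ℝ)) → ∀ τ ∈ J, ∀ s : ℝ, DifferentiableAt ℝ (fun τ' => F (τ', s)) τ := by
    intro F hF τ hτ s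
    have hd : DifferentiableAt ℝ F (τ, s) := (hF.contDiffAt (hS.mem_nhds (show ((τ, s) : ℝ × ℝ) ∈ (Prod.fst ⁻¹' J : Set (ℝ × ℝ)) from hτ))).differentiableAt (by simp)
    exact (hd.hasFDerivAt.comp_hasDerivAt τ (hline s τ)).differentiableAt
  have hΩd : ∀ τ ∈ J, DifferentiableAt ℝ Ω τ := fun τ hτ =>
    ((hsliceT hKss τ hτ s₀).neg).div (hsliceT hK τ hτ s₀) (hne τ hτ)
  have homd : ∀ τ ∈ J, DifferentiableAt ℝ om τ := fun τ hτ => (hΩd τ hτ).sqrt (hΩpos τ hτ).ne'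
  -- the coefficient functions
  set α : ℝ → ℝ := fun τ => K (τ, 0) with hα_def
  set β : ℝ → ℝ := fun τ => Ks (τ, 0) / om τ with hβ_def
  have hαd : ∀ τ ∈ J, DifferentiableAt ℝ α τ := fun τ hτ => hsliceT hK τ hτ 0
  have hβd : ∀ τ ∈ J, DifferentiableAt ℝ β τ := fun τ hτ => (hsliceT hKs τ hτ 0).div (homd τ hτ) (hompos τ hτ).ne'
  have hrepαβ : ∀ τ ∈ J, ∀ s, K (τ, s) = α τ * Real.cos (om τ * s) + β τ * Real.sin (om τ * s) := by
    intro τ hτ s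
    obtain ⟨w, a, b, hw, hrep⟩ := htrig τ hτ
    have hwom : w = om τ := homrep τ hτ w a b hw hrep
    have ha : a = α τ := by
      rw [hα_def]; simp only
      rw [hrep 0]; simp
    have hb : b = β τ := by
      rw [hβ_def]; simp only
      rw [hKs_def]; simp only
      rw [(slice_derivs_of_trig hJ hK hτ hrep 0).1, ← hwom]
      simp only [mul_zero, Real.sin_zero, Real.cos_zero, mul_one, zero_add]
      field_simp
    rw [hrep s, ha, hb, hwom]
  -- the nontriviality of the coefficients
  have hαβ : ∀ τ ∈ J, α τ ≠ 0 ∨ β τ ≠ 0 := by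
    intro τ hτ
    by_contra h
    push Not at h
    have h0 := hrepαβ τ hτ s₀
    rw [h.1, h.2] at h0
    simp at h0
    exact hne τ hτ h0
  -- om has zero derivative at every point of J
  have hom' : ∀ τ ∈ J, deriv om τ = 0 := by
    intro τ hτ
    obtain ⟨M, hM, hlipτ⟩ := hlip τ hτ
    have hbound : ∀ s : ℝ, |0 + deriv α τ * Real.cos (om τ * s) + deriv β τ * Real.sin (om τ * s) +
        deriv om τ * s * (-α τ * Real.sin (om τ * s) + β τ * Real.cos (om τ * s))| ≤ M := by
      intro s
      -- the explicit derivative of `τ' ↦ K(τ',s)` at `τ`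
      have hG : HasDerivAt (fun τ' => α τ' * Real.cos (om τ' * s) + β τ' * Real.sin (om τ' * s))
          (0 + deriv α τ * Real.cos (om τ * s) + deriv β τ * Real.sin (om τ * s) +
            deriv om τ * s * (-α τ * Real.sin (om τ * s) + β τ * Real.cos (om τ * s))) τ := by
        have homs : HasDerivAt (fun τ' => om τ' * s) (deriv om τ * s) τ := (homd τ hτ).hasDerivAt.mul_const s
        have hc : HasDerivAt (fun τ' => Real.cos (om τ' * s)) (-Real.sin (om τ * s) * (deriv om τ * s)) τ := homs.cos
        have hs : HasDerivAt (fun τ' => Real.sin (om τ' * s)) (Real.cos (om τ * s) * (deriv om τ * s)) τ := homs.sin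
        have h := ((hαd τ hτ).hasDerivAt.mul hc).add ((hβd τ hτ).hasDerivAt.mul hs)
        exact h.congr_deriv (by ring)
      have hGK : HasDerivAt (fun τ' => K (τ', s))
          (0 + deriv α τ * Real.cos (om τ * s) + deriv β τ * Real.sin (om τ * s) +
            deriv om τ * s * (-α τ * Real.sin (om τ * s) + β τ * Real.cos (om τ * s))) τ := by
        refine hG.congr_of_eventuallyEq ?_
        filter_upwards [hJ.mem_nhds hτ] with τ' hτ' using hrepαβ τ' hτ' s
      have hle := hGK.le_of_lip' hM (by
        filter_upwards [hlipτ s] with τ' hτ'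
        simpa [Real.norm_eq_abs] using hτ')
      simpa [Real.norm_eq_abs] using hle
    obtain ⟨h1, h2⟩ := frequency_locked (hompos τ hτ).ne' hbound
    rcases hαβ τ hτ with hα | hβ
    · exact (mul_eq_zero.1 h1).resolve_right hα
    · exact (mul_eq_zero.1 h2).resolve_right hβ
  -- hence om is constant on J
  by_cases hJne : J.Nonempty
  · obtain ⟨τ₁, hτ₁⟩ := hJne
    refine ⟨om τ₁, hompos τ₁ hτ₁, fun τ hτ w a b hw hrep => ?_⟩
    rw [homrep τ hτ w a b hw hrep]
    exact hJ.is_const_of_deriv_eq_zero hJc (fun x hx => (homd x hx).differentiableWithinAt) (fun x hx => hom' x hx) hτ hτ₁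
  · refine ⟨1, one_pos, fun τ hτ => ?_⟩
    exact absurd ⟨τ, hτ⟩ hJne

end Summit.NavierStokesRegularity.NavierStokesRegularity.Theorems.PoloidalWindowDoorLrcModEntireSonicSheetFrequency

end
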